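import Mathlib

/-!
# PneNP / OverlapGapAlgebra — crux `SolvableImpliesStableSection` (stmt-PneNP-2463):
# the MONOTONE REPAIR block (12/·) — clause-walks up a syntactically valid tree

Support for crux `stmt-PneNP-2463` (`Summit.PneNP.PneNP.Theses.OverlapGapAlgebra.SolvableImpliesStableSection`):
the f-free block "bounded-round monotone repair gives stable sections up to `α ≤ 2^k/(4k)`".
In a tree code `T` (finite set of labelled addresses, child of `a` at slot `j` sits at `j :: a`) that
is syntactically valid in `Φ`, every edge from a node `(a, (x, r))` to a child `(j :: a, (y, s))` is a
shared variable: `(x, j)` is a POSITIVE slot of the parent and carries the variable of the least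
NEGATIVE slot of the child's clause `y`.  Walking from a node up to the root therefore gives a
clause-walk whose in-slots are positive and whose out-slots are negative:

* `sissR_edge_facts` — the sign and variable facts of a tree edge;
* `sissR_upWalk` — for every node `(a, (x, r))`: a clause-walk `w 0 = x, …, w |a| = root clause`
  with the step equations, positive in-slots, negative out-slots, and `w d` the clause at the
  ancestor address `a.drop d`.
No definitions (all objects are hypotheses); axioms `propext`, `Classical.choice`, `Quot.sound`.
-/

set_option linter.dupNamespace false -- `Summit.PneNP.PneNP.…`: summit = sub-problem (D-0017)

namespace Summit.PneNP.PneNP.Theorems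

open Finset
open scoped Classical

section TreeWalks

variable {m k n : ℕ}

/-- **Edge facts.** In a syntactically valid tree code, for a node `(a, (x, r))` with child
`(j :: a, (y, s))`: the slot `(x, j)` is positive, and for the least childless slot `jn` of the child
— which is the least negative slot of `y` — `var(x, j) = var(y, jn)`. -/
theorem sissR_edge_facts (T : Finset (List (Fin k) × (Fin m × ℕ))) (Φ : (Fin m → Fin k → Fin n × Bool))
    (hsyn : ∀ e ∈ T, ∀ j : Fin k,
      (((Φ e.2.1 j).2 = true ↔ ∃ lab : Fin m × ℕ, (j :: e.1, lab) ∈ T) ∧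
      ∀ (y : Fin m) (s : ℕ), (j :: e.1, (y, s)) ∈ T → ∃ j' : Fin k,
        (∀ lab : Fin m × ℕ, (j' :: j :: e.1, lab) ∉ T) ∧
        (∀ j'' : Fin k, j'' < j' → ∃ lab : Fin m × ℕ, (j'' :: j :: e.1, lab) ∈ T) ∧
        (Φ e.2.1 j).1 = (Φ y j').1))
    (a : List (Fin k)) (x : Fin m) (r : ℕ) (ha : (a, (x, r)) ∈ T)
    (j : Fin k) (y : Fin m) (s : ℕ) (hch : (j :: a, (y, s)) ∈ T) :
    (Φ x j).2 = true ∧ ∃ jn : Fin k,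
      ((Φ y jn).2 = false ∧ ∀ j'' : Fin k, j'' < jn → (Φ y j'').2 = true) ∧
      (Φ x j).1 = (Φ y jn).1 := by
  obtain ⟨hsgn, hchild⟩ := hsyn (a, (x, r)) ha j
  refine ⟨hsgn.2 ⟨(y, s), hch⟩, ?_⟩
  obtain ⟨jn, hno, hlt, heq⟩ := hchild y s hch
  refine ⟨jn, ⟨?_, fun j'' hj'' => ?_⟩, heq⟩
  · -- `jn` is childless at the child node, hence negative in `y`
    have hiff := (hsyn (j :: a, (y, s)) hch jn).1
    by_contra hcon
    have h' : (Φ y jn).2 = true := by simpa using hcon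
    obtain ⟨lab, hlab⟩ := hiff.1 h'
    exact hno lab hlab
  · obtain ⟨lab, hlab⟩ := hlt j'' hj''
    exact ((hsyn (j :: a, (y, s)) hch j'').1).2 ⟨lab, hlab⟩

/-- **The walk from a node up to the root.** In a functional, parent-closed, syntactically valid tree
code with root clause `c`, for every node `(a, (x, r))` there is a clause-walk `w, u, o` of length
`|a|` with `w 0 = x`, `w |a| = c`, the step equations `var(w (d+1), u (d+1)) = var(w d, o d)`,
positive in-slots `(w i, u i)` (`1 ≤ i ≤ |a|`), negative out-slots `(w d, o d)` (`d < |a|`), and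
`w d` the clause at the ancestor address `a.drop d`. -/
theorem sissR_upWalk (T : Finset (List (Fin k) × (Fin m × ℕ))) (Φ : (Fin m → Fin k → Fin n × Bool))
    (hfun : ∀ (a : List (Fin k)) (lab lab' : Fin m × ℕ), (a, lab) ∈ T → (a, lab') ∈ T → lab = lab')
    (hpar : ∀ (j : Fin k) (a : List (Fin k)) (lab : Fin m × ℕ), (j :: a, lab) ∈ T →
      ∃ lab' : Fin m × ℕ, (a, lab') ∈ T)
    (hsyn : ∀ e ∈ T, ∀ j : Fin k,
      (((Φ e.2.1 j).2 = true ↔ ∃ lab : Fin m × ℕ, (j :: e.1, lab) ∈ T) ∧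
      ∀ (y : Fin m) (s : ℕ), (j :: e.1, (y, s)) ∈ T → ∃ j' : Fin k,
        (∀ lab : Fin m × ℕ, (j' :: j :: e.1, lab) ∉ T) ∧
        (∀ j'' : Fin k, j'' < j' → ∃ lab : Fin m × ℕ, (j'' :: j :: e.1, lab) ∈ T) ∧
        (Φ e.2.1 j).1 = (Φ y j').1))
    (c : Fin m) (rc : ℕ) (hroot : (([] : List (Fin k)), (c, rc)) ∈ T) (j₀ : Fin k) :
    ∀ (a : List (Fin k)) (x : Fin m) (r : ℕ), (a, (x, r)) ∈ T →
      ∃ (w : ℕ → Fin m) (u o : ℕ → Fin k), w 0 = x ∧ w a.length = c ∧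
        (∀ d, d < a.length → (Φ (w (d + 1)) (u (d + 1))).1 = (Φ (w d) (o d)).1) ∧
        (∀ i, 1 ≤ i → i ≤ a.length → (Φ (w i) (u i)).2 = true) ∧
        (∀ d, d < a.length → (Φ (w d) (o d)).2 = false) ∧
        (∀ d, d ≤ a.length → ∃ r' : ℕ, (a.drop d, (w d, r')) ∈ T) := by
  intro a
  induction a with
  | nil =>
    intro x r ha
    have hxc : x = c := by
      have := hfun [] (x, r) (c, rc) ha hroot
      exact (Prod.mk.inj this).1
    refine ⟨fun _ => x, fun _ => j₀, fun _ => j₀, rfl, hxc, fun d hd => absurd hd (Nat.not_lt_zero d),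
      fun i h1 h2 => by simp at h2; omega, fun d hd => absurd hd (Nat.not_lt_zero d), fun d hd => ?_⟩
    have hd0 : d = 0 := by simpa using hd
    subst hd0
    exact ⟨r, by simpa using ha⟩
  | cons j a' ih =>
    intro x r ha
    obtain ⟨⟨x', r'⟩, ha'⟩ := hpar j a' (x, r) ha
    obtain ⟨w', u', o', hw0, hwlen, hsteps, hin, hout, hnode⟩ := ih x' r' ha'
    obtain ⟨hsgn, jn, ⟨hjn, _⟩, heq⟩ := sissR_edge_facts T Φ hsyn a' x' r' ha' j x r ha
    refine ⟨fun i => if i = 0 then x else w' (i - 1),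
      fun i => if i = 1 then j else u' (i - 1),
      fun i => if i = 0 then jn else o' (i - 1), by simp, ?_, ?_, ?_, ?_, ?_⟩
    · have hne0 : a'.length + 1 ≠ 0 := by omega
      simp only [List.length_cons, hne0, if_false, Nat.add_sub_cancel]
      exact hwlen
    · intro d hd
      rw [List.length_cons] at hd
      rcases Nat.eq_zero_or_pos d with rfl | hdpos
      · simp only [Nat.zero_add, if_true, one_ne_zero, if_false, Nat.sub_self]
        rw [hw0]
        exact heq
      · have h1 : d + 1 ≠ 1 := by omega
        have h2 : d + 1 ≠ 0 := by omega
        have h3 : d ≠ 0 := by omega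
        simp only [h1, h2, h3, if_false, Nat.add_sub_cancel]
        have := hsteps (d - 1) (by omega)
        rwa [Nat.sub_add_cancel hdpos] at this
    · intro i h1 h2
      rw [List.length_cons] at h2
      by_cases hi1 : i = 1
      · subst hi1
        simp only [if_true, one_ne_zero, if_false, Nat.sub_self]
        rw [hw0]
        exact hsgn
      · have h3 : i ≠ 0 := by omega
        simp only [hi1, h3, if_false]
        exact hin (i - 1) (by omega) (by omega)
    · intro d hd
      rw [List.length_cons] at hd
      rcases Nat.eq_zero_or_pos d with rfl | hdpos
      · simp only [if_true]
        exact hjn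
      · have h3 : d ≠ 0 := by omega
        simp only [h3, if_false]
        exact hout (d - 1) (by omega)
    · intro d hd
      rw [List.length_cons] at hd
      rcases Nat.eq_zero_or_pos d with rfl | hdpos
      · simp only [if_true, List.drop_zero]
        exact ⟨r, ha⟩
      · have h3 : d ≠ 0 := by omega
        simp only [h3, if_false]
        obtain ⟨r'', hr''⟩ := hnode (d - 1) (by omega)
        refine ⟨r'', ?_⟩
        have hdrop : (j :: a').drop d = a'.drop (d - 1) := by
          obtain ⟨e, rfl⟩ := Nat.exists_eq_add_of_le hdpos
          rw [Nat.add_comm, List.drop_succ_cons, Nat.add_sub_cancel]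
        rw [hdrop]
        exact hr''

end TreeWalks

end Summit.PneNP.PneNP.Theorems
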